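import Summits.ABC.IUTFork.Conditional.AbcOfSlotLicenceGenuineMRead
import HarnessLib

/-!
# Branch C, M line (summand route) — the reading-(P) DOWNSTREAM STATEMENT line, θ-CUT, READ 0: `ABC` ⟸ the typed [IUTchIII] Cor. 3.12 conclusion
# IN READING (P) (`SlotStatement` of the M-level sharp setting of the datum's own ideles) ON THE CONTENT LOCUS only; explicit 1 · CONE 0 · READ 0 · PIN 0 · SIDE 0 · PROV 0

C scoreboard (abc-iut-C-cert-1 gen 6; the open EVEN item (i) of this seat's gen-5 HANDOFF: M twins of abc-iut-s2-p10's K file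
`AbcOfSlotStatementGenuineKContent.lean` §4, p466752). PROOF-ONLY (no `def`, no new `Prop`): DATA = the M books' section variables VERBATIM (p468614 / p469493);
binder texts = this seat's `abc_of_slotLicence_orNumP_M_content_read` content guard (p469493, = abc-iut-C-cert-1's θ-guard of p459802 / p461361) and
`abc_of_slotStatement_genuineM_szpiroBad_read`'s setting term, VERBATIM. Per datum `GenuineMSlot.cor312PerImageOf_of_slotStatement_read` (p469493; READ-P-M =
abc-iut-C-cert-2's p469199 folded) turns `SlotStatement` into `T.Cor312PerImageOf`, and the γ-θ M certificate `abc_of_slotLicence_orNumP_M_content_read` closes.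

* **`abc_of_slotStatement_genuineM_content_offLicence_read`** — `ABC` from ONE hypothesis [C312-P-M, content, off-licence] `hstPOffC_M` «at every admissible
  `(P, l)` ON THE CONTENT LOCUS and every genuine `T` there at which OUR M-level SLOT licence FAILS, `SlotStatement`»; explicit 1.
* **`abc_of_slotStatement_genuineM_content_read`** — `ABC` from ONE hypothesis [C312-P-M, content] `hstPC_M` «… at every genuine `T`»; explicit 1 (the θ-cut of
  `abc_of_slotStatement_genuineM_szpiroBad_read`: Szpiro-bad antecedent REPLACED by the content guard, all else verbatim).

HONEST STRENGTH (numbers about OUR typed objects, no side): both are WEAKER-OR-EQUAL THEOREMS than the γ-θ M certificate (per datum `SlotStatement ⟹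
T.Cor312PerImageOf`, not conversely — archimedean slack); `hstPOffC_M` / `hstPC_M` demand nothing at any `(P, l)` with `log q^{∤{2,l}}(λ) ≤ 120·d*_mod·l`
(`d*_mod = 2¹²·3³·5·d_mod`), hence at NO known or tabulated datum; content ⟹ Szpiro-bad (abc-iut-C-cert-1 `szpiroBad_of_content`), so they are weaker than
`abc_of_slotStatement_genuineM_szpiroBad_read`'s `hstPBad`. The M-level SLOT licence (last slot; decided exactly by abc-iut-C-cert-2's p470778) is a STRONGER
reading of [IUTchIII] Step (xi-f)/(x) than print's hull of the union. Nothing here asserts that abc is proved or refuted, that [IUTchIII] Cor. 3.12 / [IUTchIV]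
Thm. 1.10 holds or fails at any datum, or takes a side on any author or on (U)/(P); a cut discharges nothing; typed ≠ proved; instantiated ≠ endorsed.
[claim: Mochizuki2012, status: disputed] [cite: Mochizuki2012, IUTchIII Cor. 3.12 p. 173–174, Step (x) p. 181, Step (xi-f) p. 184; IUTchIV Thm. 1.10 p. 22–23,
Step (vii)–(viii) p. 30] [cite: DupuyHilado2025, §1 (1.1), §4.10–4.12]
-/

noncomputable section

open Set Function NumberField IsDedekindDomain

namespace Summit.ABC.IUTFork.Conditional

open Thm311 Thm311.Real Cor312 Cor312Vol Cor312Prov Literature.IUT.LogThetaLattice Literature.IUT.LogVolume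
  Literature.IUT.HodgeTheaters Literature.IUT.LogVolume.ThetaData Literature.NumberTheory.NumberFields
open Literature.NumberTheory.DiophantineGeometry.GenEll Summit.ABC.ABC.Theorems

section Family

/-! ## §0 DATA — the M books' section variables VERBATIM (p468614 / p469493) -/

variable
    (M : ∀ (P : NFPoint) (l : ℕ) (T : Cor22.ThetaVolumeDatumAt P l), Type) [∀ P l T, Field (M P l T)] [∀ P l T, NumberField (M P l T)]
    (archPk : ∀ (P : NFPoint) (l : ℕ) (T : Cor22.ThetaVolumeDatumAt P l), letI := T.instFieldF; letI := T.instNumberFieldF; letI := T.instAlgebraF; letI := T.instFieldK;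
        letI := T.instNumberFieldK; letI := T.instAlgebraK; letI := T.instFieldFbar; letI := T.instAlgebraFbar;
        letI := T.instAlgebraKFbar; letI := T.instIsElliptic;
      ∀ (j : (thetaIndexOfInitial T.D).Label) (vQ : (thetaIndexOfInitial T.D).VQ), Set ((logShellsOfInitialDH T.D (analyticLogvVal T.K)).Packet j vQ))
    (archSub : ∀ (P : NFPoint) (l : ℕ) (T : Cor22.ThetaVolumeDatumAt P l), letI := T.instFieldF; letI := T.instNumberFieldF; letI := T.instAlgebraF; letI := T.instFieldK;
        letI := T.instNumberFieldK; letI := T.instAlgebraK; letI := T.instFieldFbar; letI := T.instAlgebraFbar;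
        letI := T.instAlgebraKFbar; letI := T.instIsElliptic;
      ∀ (j : (thetaIndexOfInitial T.D).Label) (v : (thetaIndexOfInitial T.D).V), Set ((logShellsOfInitialDH T.D (analyticLogvVal T.K)).Packet j ((thetaIndexOfInitial T.D).over v)))
    (Ψ : ∀ (P : NFPoint) (l : ℕ) (T : Cor22.ThetaVolumeDatumAt P l), letI := T.instFieldF; letI := T.instNumberFieldF; letI := T.instAlgebraF; letI := T.instFieldK;
        letI := T.instNumberFieldK; letI := T.instAlgebraK; letI := T.instFieldFbar; letI := T.instAlgebraFbar;
        letI := T.instAlgebraKFbar; letI := T.instIsElliptic;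
      ℤ → ∀ v : (thetaIndexOfInitial T.D).V, v ∈ (thetaIndexOfInitial T.D).Vbad → Set ((logShellsOfInitialDH T.D (analyticLogvVal T.K)).StarPacket v))
    (act : ∀ (P : NFPoint) (l : ℕ) (T : Cor22.ThetaVolumeDatumAt P l), letI := T.instFieldF; letI := T.instNumberFieldF; letI := T.instAlgebraF; letI := T.instFieldK;
        letI := T.instNumberFieldK; letI := T.instAlgebraK; letI := T.instFieldFbar; letI := T.instAlgebraFbar;
        letI := T.instAlgebraKFbar; letI := T.instIsElliptic;
      ℤ → ∀ v : (thetaIndexOfInitial T.D).V, v ∈ (thetaIndexOfInitial T.D).Vbad → (logShellsOfInitialDH T.D (analyticLogvVal T.K)).StarPacket v → Module.End ℚ ((logShellsOfInitialDH T.D (analyticLogvVal T.K)).StarPacket v))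
    (Mmod : ∀ (P : NFPoint) (l : ℕ) (T : Cor22.ThetaVolumeDatumAt P l), letI := T.instFieldF; letI := T.instNumberFieldF; letI := T.instAlgebraF; letI := T.instFieldK;
        letI := T.instNumberFieldK; letI := T.instAlgebraK; letI := T.instFieldFbar; letI := T.instAlgebraFbar;
        letI := T.instAlgebraKFbar; letI := T.instIsElliptic;
      ℤ → ∀ j : (thetaIndexOfInitial T.D).LabelStar, Set ((logShellsOfInitialDH T.D (analyticLogvVal T.K)).GlobalPacket j.1))
    (region : ∀ (P : NFPoint) (l : ℕ) (T : Cor22.ThetaVolumeDatumAt P l), letI := T.instFieldF; letI := T.instNumberFieldF; letI := T.instAlgebraF; letI := T.instFieldK;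
        letI := T.instNumberFieldK; letI := T.instAlgebraK; letI := T.instFieldFbar; letI := T.instAlgebraFbar;
        letI := T.instAlgebraKFbar; letI := T.instIsElliptic;
      ℤ → ∀ j : (thetaIndexOfInitial T.D).LabelStar, FinDivisor (M P l T) → ∀ vQ : (thetaIndexOfInitial T.D).VQ, Set ((logShellsOfInitialDH T.D (analyticLogvVal T.K)).Packet j.1 vQ))
    (n : ∀ (P : NFPoint) (l : ℕ) (T : Cor22.ThetaVolumeDatumAt P l), ℤ)
    {HT : ∀ (P : NFPoint) (l : ℕ) (T : Cor22.ThetaVolumeDatumAt P l), Type} {LogLink : ∀ (P : NFPoint) (l : ℕ) (T : Cor22.ThetaVolumeDatumAt P l), HT P l T → HT P l T → Type}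
    {IsFull : ∀ (P : NFPoint) (l : ℕ) (T : Cor22.ThetaVolumeDatumAt P l), ∀ {s t : HT P l T}, LogLink P l T s t → Prop}
    (lat : ∀ (P : NFPoint) (l : ℕ) (T : Cor22.ThetaVolumeDatumAt P l), LGPGaussianLogThetaLattice (LogLink P l T) (IsFull P l T))
    {Frd : ∀ (P : NFPoint) (l : ℕ) (T : Cor22.ThetaVolumeDatumAt P l), Type} {IsoF : ∀ (P : NFPoint) (l : ℕ) (T : Cor22.ThetaVolumeDatumAt P l), Frd P l T → Frd P l T → Type} {Ob : ∀ (P : NFPoint) (l : ℕ) (T : Cor22.ThetaVolumeDatumAt P l), Frd P l T → Type}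
    {realify : ∀ (P : NFPoint) (l : ℕ) (T : Cor22.ThetaVolumeDatumAt P l), Frd P l T → Frd P l T} {Strip : ∀ (P : NFPoint) (l : ℕ) (T : Cor22.ThetaVolumeDatumAt P l), Type} {IsoS : ∀ (P : NFPoint) (l : ℕ) (T : Cor22.ThetaVolumeDatumAt P l), Strip P l T → Strip P l T → Type}
    {Mv : ∀ (P : NFPoint) (l : ℕ) (T : Cor22.ThetaVolumeDatumAt P l), letI := T.instFieldF; letI := T.instNumberFieldF; letI := T.instAlgebraF; letI := T.instFieldK;
        letI := T.instNumberFieldK; letI := T.instAlgebraK; letI := T.instFieldFbar; letI := T.instAlgebraFbar;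
        letI := T.instAlgebraKFbar; letI := T.instIsElliptic;
      ∀ v : (thetaIndexOfInitial T.D).V, v ∈ (thetaIndexOfInitial T.D).Vbad → Type}
    [∀ P l T v h, Monoid (Mv P l T v h)]
    (sig : ∀ (P : NFPoint) (l : ℕ) (T : Cor22.ThetaVolumeDatumAt P l), letI := T.instFieldF; letI := T.instNumberFieldF; letI := T.instAlgebraF; letI := T.instFieldK;
        letI := T.instNumberFieldK; letI := T.instAlgebraK; letI := T.instFieldFbar; letI := T.instAlgebraFbar;
        letI := T.instAlgebraKFbar; letI := T.instIsElliptic;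
      GlobalLGPFrobenioidSignature (thetaIndexOfInitial T.D).lstar (thetaIndexOfInitial T.D).V (· ∈ (thetaIndexOfInitial T.D).Vbad) (Frd P l T) (IsoF P l T) (Ob P l T) (realify P l T)
        (Strip P l T) (IsoS P l T) (Mv P l T))
    (split : ∀ (P : NFPoint) (l : ℕ) (T : Cor22.ThetaVolumeDatumAt P l), SplittingMonoids (Mv P l T))
    {ObΔ : ∀ (P : NFPoint) (l : ℕ) (T : Cor22.ThetaVolumeDatumAt P l), Type}
    {N : ∀ (P : NFPoint) (l : ℕ) (T : Cor22.ThetaVolumeDatumAt P l), letI := T.instFieldF; letI := T.instNumberFieldF; letI := T.instAlgebraF; letI := T.instFieldK;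
        letI := T.instNumberFieldK; letI := T.instAlgebraK; letI := T.instFieldFbar; letI := T.instAlgebraFbar;
        letI := T.instAlgebraKFbar; letI := T.instIsElliptic;
      ∀ v : (thetaIndexOfInitial T.D).V, v ∈ (thetaIndexOfInitial T.D).Vbad → Type}
    [∀ P l T v h, Monoid (N P l T v h)] (qData : ∀ (P : NFPoint) (l : ℕ) (T : Cor22.ThetaVolumeDatumAt P l), QPilotData (ObΔ P l T) (N P l T))

/-! ## §1 The reading-(P) DOWNSTREAM STATEMENT line at the M level, θ-cut, READ 0 — explicit 1 -/

/-- **`abc_of_slotStatement_genuineM_content_offLicence_read`** — `ABC` from ONE hypothesis [C312-P-M, content, off-licence] `hstPOffC_M` «at every admissible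
`(P, l)` ON THE CONTENT LOCUS of [IUTchIV] Thm. 1.10's display and every genuine `T` there at which OUR M-level SLOT licence FAILS (summand route, the datum's own
ideles), the typed Cor. 3.12 conclusion IN READING (P), `SlotStatement`» — per datum `GenuineMSlot.cor312PerImageOf_of_slotStatement_read` into this seat's γ-θ M
certificate `abc_of_slotLicence_orNumP_M_content_read` (p469493). Explicit 1; CONE 0 · READ 0 · PIN 0 · SIDE 0 · PROV 0. M twin of abc-iut-s2-p10's
`abc_of_slotStatement_genuineK_content_offLicence_read` (p466752). «`ABC` follows from this hypothesis as typed» — demanded at no known datum; no side taken;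
typed ≠ proved. [claim: Mochizuki2012, status: disputed] [cite: Mochizuki2012, IUTchIII Cor. 3.12 p. 174; IUTchIV Thm. 1.10 p. 22–23, Step (viii) p. 30] -/
theorem abc_of_slotStatement_genuineM_content_offLicence_read
    (hstPOffC : ∀ (P : NFPoint), P ∈ UP → ∀ (l : ℕ), l.Prime → 5 ≤ l →
      Cor22.AdmitsCore P → Cor22.CondP2 P l → Cor22.CondP5 P l → Cor22.CondP6 P l →
      6 * ((1 + 20 * (Cor22.dmod P : ℝ) / l) * (P.logDiff + Cor22.logCondAvoid P {2, l}))
          + 120 * (2 ^ 12 * 3 ^ 3 * 5 * (Cor22.dmod P : ℝ) * l) < Cor22.logQAvoid P {2, l} →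
      ∀ (T : Cor22.ThetaVolumeDatumAt P l), letI := T.instFieldF; letI := T.instNumberFieldF; letI := T.instAlgebraF; letI := T.instFieldK;
        letI := T.instNumberFieldK; letI := T.instAlgebraK; letI := T.instFieldFbar; letI := T.instAlgebraFbar;
        letI := T.instAlgebraKFbar; letI := T.instIsElliptic;
      ¬ (settingPrVolSharpM T.D (logvAnalyticVal_analyticLogvVal (K := T.K)) (tOfIdeleData T.D (ideleDataOf T.D T.isVolumeInputOf))
          (fun u x => tqM T.D (ratChar u) u (natCast_ratChar_mem u) (ideleDataOf T.D T.isVolumeInputOf) x)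
          (M P l T) (archPk P l T) (archSub P l T) (Ψ P l T) (act P l T)
          (Mmod P l T) (region P l T) (n P l T) (lat P l T) (sig P l T) (split P l T) (qData P l T)
          (fun u x => tqM_ne_zero T.D (ratChar u) u (natCast_ratChar_mem u) (ideleDataOf T.D T.isVolumeInputOf) x)
          (GenuineM.finite_ratPlaces_under_S T.D).toFinset
          (fun u x hu => norm_tqM_eq_one_of_not_mem T.D (ratChar u) u (natCast_ratChar_mem u) (ideleDataOf T.D T.isVolumeInputOf) x
            fun hx => hu ((Set.Finite.mem_toFinset _).mpr ⟨x, hx⟩))).SlotLicence →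
        (settingPrVolSharpM T.D (logvAnalyticVal_analyticLogvVal (K := T.K)) (tOfIdeleData T.D (ideleDataOf T.D T.isVolumeInputOf))
            (fun u x => tqM T.D (ratChar u) u (natCast_ratChar_mem u) (ideleDataOf T.D T.isVolumeInputOf) x)
            (M P l T) (archPk P l T) (archSub P l T) (Ψ P l T) (act P l T)
            (Mmod P l T) (region P l T) (n P l T) (lat P l T) (sig P l T) (split P l T) (qData P l T)
            (fun u x => tqM_ne_zero T.D (ratChar u) u (natCast_ratChar_mem u) (ideleDataOf T.D T.isVolumeInputOf) x)
            (GenuineM.finite_ratPlaces_under_S T.D).toFinset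
            (fun u x hu => norm_tqM_eq_one_of_not_mem T.D (ratChar u) u (natCast_ratChar_mem u) (ideleDataOf T.D T.isVolumeInputOf) x
              fun hx => hu ((Set.Finite.mem_toFinset _).mpr ⟨x, hx⟩))).SlotStatement)
    : _root_.ABC := by
  refine abc_of_slotLicence_orNumP_M_content_read M archPk archSub Ψ act Mmod region n lat sig split qData ?_
  intro P hP l hl h5 hc h2 h5' h6 hct T hlic
  exact GenuineMSlot.cor312PerImageOf_of_slotStatement_read M archPk archSub Ψ act Mmod region n lat sig split qData T
    (hstPOffC P hP l hl h5 hc h2 h5' h6 hct T hlic)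

/-- **`abc_of_slotStatement_genuineM_content_read`** — the θ-cut of `abc_of_slotStatement_genuineM_szpiroBad_read` (p469493): `ABC` from ONE hypothesis
[C312-P-M, content] `hstPC_M` «`SlotStatement` (M-level sharp setting, the datum's own ideles) at every admissible `(P, l)` ON THE CONTENT LOCUS and every genuine
`T`» (Szpiro-bad antecedent REPLACED by abc-iut-C-cert-1's content guard, all else verbatim). Explicit 1; immediate from `…_content_offLicence_read`. M twin of
abc-iut-s2-p10's `abc_of_slotStatement_genuineK_content_read`. Nothing asserted; no side taken; typed ≠ proved. [claim: Mochizuki2012, status: disputed]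
[cite: Mochizuki2012, IUTchIII Cor. 3.12 p. 174] -/
theorem abc_of_slotStatement_genuineM_content_read
    (hstPC : ∀ (P : NFPoint), P ∈ UP → ∀ (l : ℕ), l.Prime → 5 ≤ l →
      Cor22.AdmitsCore P → Cor22.CondP2 P l → Cor22.CondP5 P l → Cor22.CondP6 P l →
      6 * ((1 + 20 * (Cor22.dmod P : ℝ) / l) * (P.logDiff + Cor22.logCondAvoid P {2, l}))
          + 120 * (2 ^ 12 * 3 ^ 3 * 5 * (Cor22.dmod P : ℝ) * l) < Cor22.logQAvoid P {2, l} →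
      ∀ (T : Cor22.ThetaVolumeDatumAt P l), letI := T.instFieldF; letI := T.instNumberFieldF; letI := T.instAlgebraF; letI := T.instFieldK;
        letI := T.instNumberFieldK; letI := T.instAlgebraK; letI := T.instFieldFbar; letI := T.instAlgebraFbar;
        letI := T.instAlgebraKFbar; letI := T.instIsElliptic;
      (settingPrVolSharpM T.D (logvAnalyticVal_analyticLogvVal (K := T.K)) (tOfIdeleData T.D (ideleDataOf T.D T.isVolumeInputOf))
          (fun u x => tqM T.D (ratChar u) u (natCast_ratChar_mem u) (ideleDataOf T.D T.isVolumeInputOf) x)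
          (M P l T) (archPk P l T) (archSub P l T) (Ψ P l T) (act P l T)
          (Mmod P l T) (region P l T) (n P l T) (lat P l T) (sig P l T) (split P l T) (qData P l T)
          (fun u x => tqM_ne_zero T.D (ratChar u) u (natCast_ratChar_mem u) (ideleDataOf T.D T.isVolumeInputOf) x)
          (GenuineM.finite_ratPlaces_under_S T.D).toFinset
          (fun u x hu => norm_tqM_eq_one_of_not_mem T.D (ratChar u) u (natCast_ratChar_mem u) (ideleDataOf T.D T.isVolumeInputOf) x
            fun hx => hu ((Set.Finite.mem_toFinset _).mpr ⟨x, hx⟩))).SlotStatement)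
    : _root_.ABC :=
  abc_of_slotStatement_genuineM_content_offLicence_read M archPk archSub Ψ act Mmod region n lat sig split qData
    (fun P hP l hl h5 hc h2 h5' h6 hct T _ => hstPC P hP l hl h5 hc h2 h5' h6 hct T)

end Family

end Summit.ABC.IUTFork.Conditional

end
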